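import Mathlib
import Summits.MatrixMultiplication.MatrixMultiplication.Theses.SnSubsetDichotomy
import Literature.Barriers.MatrixMultiplication.NilpotentGroupBarrierSemisimple
import Literature.Combinatorics.Additive.TPPGroupAlgebra

/-!
# `SnSubsetDichotomy.NoThresholdSubsetTriple`, line `two-modular-loewy-slice-rank` — stub
# `stub_transfer`

The transfer "slice-rank saving `C⁺` ⇒ crux" (crux `stmt-MatrixMultiplication-8302`, registered
stub `stub_transfer` of `Cruxes/NoThresholdSubsetTriple/Lines/two-modular-loewy-slice-rank.lean`;
Blasiak–Church–Cohn–Grochow–Umans 2017, §6 and Prop. B.6).  Over ANY field `F`: if the slice rank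
of the group tensor `D_{S_n}(x,y,z) = [xyz = 1]` (`mulGroupTensor F (Equiv.Perm (Fin n))`) is
eventually `≤ n!·e^{−K√n}` for some `K > 0`, then every triple `S, T, U ⊆ S_n` with the triple
product property has `|S||T||U| ≤ (n!)^{3/2}·e^{−(K/2)√n}` eventually, i.e.
`NoThresholdSubsetTriple` holds with `c := K/2` and the same threshold `n₀`.

Proof.  Fix `n ≥ n₀` and a TPP triple `S, T, U` with `|S||T||U| > (n!)^{3/2} e^{−(K/2)√n}`.
Then the three sets are non-empty, and packing (`RealizesTPP.mul_le_card`, applied to the three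
cyclic rotations of the triple, `TripleProductProperty.rotate`) gives `|S||T|, |T||U|, |U||S| ≤ n!`,
so `N := min(|S|,|T|,|U|)` satisfies `|S||T||U| ≤ N·n!`, whence `√(n!)·e^{−(K/2)√n} < N` and
`n!·e^{−K√n} < N²`.  Shrinking the three sets to `N`-subsets (`Finset.exists_subset_card_eq`,
`TripleProductProperty.mono`) shows that `S_n` realizes `⟨N,N,N⟩`, so
`N² ≤ slice-rank D_{S_n}` by the tree theorem
`BCCGU2017_propB6.sq_le_sliceRank_of_realizesTPP BCCGU2017_propB6_holds` (Cohn–Umans embedding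
+ BCCGU 2017, Prop. B.6) — contradicting the hypothesis `slice-rank D_{S_n} ≤ n!·e^{−K√n}`.
-/

namespace Summit.MatrixMultiplication.MatrixMultiplication.Theorems

open Literature.Barriers.MatrixMultiplication Literature.Combinatorics.Additive
open Literature.Computability.AlgebraicComplexity
open Summit.MatrixMultiplication.MatrixMultiplication.Theses.SnSubsetDichotomy

/-- **Packing for a TPP triple in `S_n`, all three rotations.**  If `S, T, U ⊆ S_n` have the triple
product property and are non-empty, then `|S||T| ≤ n!`, `|T||U| ≤ n!` and `|U||S| ≤ n!`
(Cohn–Umans 2003, proof of Lemma 3.1: `(s,t) ↦ s⁻¹t` is injective on `S × T`; the property is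
invariant under cyclic rotation). [folklore] -/
theorem tpp_perm_card_mul_card_le_factorial {n : ℕ} {S T U : Finset (Equiv.Perm (Fin n))}
    (hTPP : TripleProductProperty S T U) (hS : S.card ≠ 0) (hT : T.card ≠ 0) (hU : U.card ≠ 0) :
    S.card * T.card ≤ n.factorial ∧ T.card * U.card ≤ n.factorial ∧
      U.card * S.card ≤ n.factorial := by
  have hcard : Fintype.card (Equiv.Perm (Fin n)) = n.factorial := by
    rw [Fintype.card_perm, Fintype.card_fin]
  refine ⟨?_, ?_, ?_⟩
  · exact (RealizesTPP.mul_le_card (G := Equiv.Perm (Fin n))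
      ⟨S, T, U, rfl, rfl, rfl, hTPP⟩ hU).trans_eq hcard
  · exact (RealizesTPP.mul_le_card (G := Equiv.Perm (Fin n))
      ⟨T, U, S, rfl, rfl, rfl, hTPP.rotate⟩ hS).trans_eq hcard
  · exact (RealizesTPP.mul_le_card (G := Equiv.Perm (Fin n))
      ⟨U, S, T, rfl, rfl, rfl, hTPP.rotate.rotate⟩ hT).trans_eq hcard

/-- **The balanced sub-triple step.**  If `S, T, U ⊆ S_n` have the triple product property and are
non-empty, then `|S||T||U| ≤ N · n!` for `N := min(|S|,|T|,|U|)` (the product of the two sets not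
attaining the minimum is `≤ n!` by packing). [folklore] -/
theorem tpp_perm_card_mul_le_min_mul_factorial {n : ℕ} {S T U : Finset (Equiv.Perm (Fin n))}
    (hTPP : TripleProductProperty S T U) (hS : S.card ≠ 0) (hT : T.card ≠ 0) (hU : U.card ≠ 0) :
    S.card * T.card * U.card ≤ min S.card (min T.card U.card) * n.factorial := by
  obtain ⟨hP1, hP2, hP3⟩ := tpp_perm_card_mul_card_le_factorial hTPP hS hT hU
  refine min_rec' (fun x => S.card * T.card * U.card ≤ x * n.factorial) ?_
    (min_rec' (fun x => S.card * T.card * U.card ≤ x * n.factorial) ?_ ?_)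
  · calc S.card * T.card * U.card = S.card * (T.card * U.card) := mul_assoc _ _ _
      _ ≤ S.card * n.factorial := Nat.mul_le_mul_left _ hP2
  · calc S.card * T.card * U.card = T.card * (U.card * S.card) := by ring
      _ ≤ T.card * n.factorial := Nat.mul_le_mul_left _ hP3
  · calc S.card * T.card * U.card = U.card * (S.card * T.card) := by ring
      _ ≤ U.card * n.factorial := Nat.mul_le_mul_left _ hP1

/-- **Heredity: a TPP triple in `S_n` realizes `⟨N,N,N⟩` for every `N` below its three sizes**
(shrink each set to an `N`-subset, `Finset.exists_subset_card_eq`; subsets of a TPP triple again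
have the property, `TripleProductProperty.mono`). [folklore] -/
theorem tpp_perm_realizesTPP_of_le {n : ℕ} {S T U : Finset (Equiv.Perm (Fin n))}
    (hTPP : TripleProductProperty S T U) {N : ℕ} (hNS : N ≤ S.card) (hNT : N ≤ T.card)
    (hNU : N ≤ U.card) : RealizesTPP (Equiv.Perm (Fin n)) N N N := by
  obtain ⟨S', hS'S, hS'⟩ := Finset.exists_subset_card_eq hNS
  obtain ⟨T', hT'T, hT'⟩ := Finset.exists_subset_card_eq hNT
  obtain ⟨U', hU'U, hU'⟩ := Finset.exists_subset_card_eq hNU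
  exact ⟨S', T', U', hS', hT', hU', hTPP.mono hS'S hT'T hU'U⟩

/-- **Stub `stub_transfer` — the transfer `C⁺ → crux` (line `two-modular-loewy-slice-rank` of
crux `SnSubsetDichotomy.NoThresholdSubsetTriple`).**  Over ANY field `F`: if the slice rank of
`D_{S_n}(x,y,z) = [xyz = 1]` is eventually `≤ n!·e^{−K√n}` for some `K > 0`, then
`NoThresholdSubsetTriple` holds (with `c := K/2` and the same `n₀`).
Proof: fix `n ≥ n₀` and a TPP triple `S, T, U` with `|S||T||U| > (n!)^{3/2}e^{−(K/2)√n}`; the sets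
are non-empty, packing in its three rotations (`tpp_perm_card_mul_card_le_factorial`) gives
`|S||T||U| ≤ N·n!` for `N := min(|S|,|T|,|U|)`, hence `N > √(n!)·e^{−(K/2)√n}`, i.e.
`N² > n!·e^{−K√n}`; shrinking to `N`-subsets, `S_n` realizes `⟨N,N,N⟩`
(`tpp_perm_realizesTPP_of_le`), whence `N² ≤ sliceRank (mulGroupTensor F S_n)` by the tree theorem
`BCCGU2017_propB6.sq_le_sliceRank_of_realizesTPP BCCGU2017_propB6_holds` — contradiction.
(Blasiak–Church–Cohn–Grochow–Umans 2017 = arXiv:1712.02302, §6 p. 11 and Prop. B.6;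
Cohn–Umans 2003, Thm. 2.3 / Lemma 3.1.) -/
theorem stub_transfer (F : Type) [Field F]
    (hC : ∃ K : ℝ, 0 < K ∧ ∃ n₀ : ℕ, ∀ n ≥ n₀,
      (sliceRank (mulGroupTensor F (Equiv.Perm (Fin n))) : ℝ) ≤
        (n.factorial : ℝ) * Real.exp (-(K * Real.sqrt (n : ℝ)))) :
    NoThresholdSubsetTriple := by
  obtain ⟨K, hK, n₀, hC⟩ := hC
  unfold NoThresholdSubsetTriple
  refine ⟨K / 2, half_pos hK, n₀, fun n hn S T U hTPP => ?_⟩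
  by_contra hlt
  rw [not_le] at hlt
  -- the slice-rank hypothesis at `n`
  have hCn := hC n hn
  -- (i) the three sets are non-empty
  have hprod : 0 < S.card * T.card * U.card := by
    have h0 : (0 : ℝ) < ((S.card * T.card * U.card : ℕ) : ℝ) := lt_of_le_of_lt (by positivity) hlt
    exact_mod_cast h0
  have hS0 : S.card ≠ 0 := fun h0 => by simp [h0] at hprod
  have hT0 : T.card ≠ 0 := fun h0 => by simp [h0] at hprod
  have hU0 : U.card ≠ 0 := fun h0 => by simp [h0] at hprod
  -- (ii)+(iii) packing in three rotations: `|S||T||U| ≤ N · n!` for the minimum `N`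
  have hNprod := tpp_perm_card_mul_le_min_mul_factorial hTPP hS0 hT0 hU0
  have hNS : min S.card (min T.card U.card) ≤ S.card := min_le_left _ _
  have hNT : min S.card (min T.card U.card) ≤ T.card := (min_le_right _ _).trans (min_le_left _ _)
  have hNU : min S.card (min T.card U.card) ≤ U.card :=
    (min_le_right _ _).trans (min_le_right _ _)
  generalize min S.card (min T.card U.card) = N at hNprod hNS hNT hNU
  -- (iv) shrink: `S_n` realizes `⟨N,N,N⟩`, so `N² ≤ slice-rank D_{S_n}`
  have hR : RealizesTPP (Equiv.Perm (Fin n)) N N N := tpp_perm_realizesTPP_of_le hTPP hNS hNT hNU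
  have hsq : ((N : ℝ)) ^ 2 ≤ (sliceRank (mulGroupTensor F (Equiv.Perm (Fin n))) : ℝ) := by
    exact_mod_cast BCCGU2017_propB6.sq_le_sliceRank_of_realizesTPP BCCGU2017_propB6_holds F
      (Equiv.Perm (Fin n)) hR
  -- (v) real bookkeeping: `n! · e^{-K√n} < N²`
  have hf : (0 : ℝ) < (n.factorial : ℝ) := by exact_mod_cast Nat.factorial_pos n
  set f : ℝ := (n.factorial : ℝ) with hfdef
  set e : ℝ := Real.exp (-(K / 2 * Real.sqrt (n : ℝ))) with hedef
  have he : 0 < e := Real.exp_pos _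
  have hrpow : f ^ ((3 : ℝ) / 2) = f * Real.sqrt f := by
    rw [Real.rpow_div_two_eq_sqrt _ hf.le, Real.rpow_ofNat, pow_succ, Real.sq_sqrt hf.le]
  have hee : e * e = Real.exp (-(K * Real.sqrt (n : ℝ))) := by
    rw [hedef, ← Real.exp_add]
    congr 1
    ring
  have h1 : f * Real.sqrt f * e < (N : ℝ) * f :=
    calc f * Real.sqrt f * e = f ^ ((3 : ℝ) / 2) * e := by rw [hrpow]
      _ < ((S.card * T.card * U.card : ℕ) : ℝ) := hlt
      _ ≤ (N : ℝ) * f := by rw [hfdef]; exact_mod_cast hNprod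
  have h2 : Real.sqrt f * e < (N : ℝ) := by
    refine lt_of_mul_lt_mul_left (a := f) ?_ hf.le
    calc f * (Real.sqrt f * e) = f * Real.sqrt f * e := (mul_assoc _ _ _).symm
      _ < (N : ℝ) * f := h1
      _ = f * N := mul_comm _ _
  have h3 : f * Real.exp (-(K * Real.sqrt (n : ℝ))) < (N : ℝ) ^ 2 := by
    have h0 : 0 ≤ Real.sqrt f * e := mul_nonneg (Real.sqrt_nonneg _) he.le
    calc f * Real.exp (-(K * Real.sqrt (n : ℝ))) = (Real.sqrt f * e) ^ 2 := by
          rw [mul_pow, Real.sq_sqrt hf.le, sq e, hee]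
      _ < (N : ℝ) ^ 2 := pow_lt_pow_left₀ h2 h0 two_ne_zero
  -- contradiction with `C⁺` at `n`
  exact absurd (hsq.trans hCn) (not_le.2 h3)

end Summit.MatrixMultiplication.MatrixMultiplication.Theorems
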